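import Summits.BirchSwinnertonDyer.BirchSwinnertonDyer.Theorems.ThetaPartnerAtTwoSignedMainConjectureCMTwoRankZeroLowerOffTwoRobust
import Summits.BirchSwinnertonDyer.BirchSwinnertonDyer.Theorems.ThetaPartnerAtTwoSignedKatoUpToAtTwoIwasawaInvolutionCompat
import HarnessLib

/-!
# Route `ThetaPartnerAtTwo` (TP2), crux K2R0P♭ `SignedMainConjectureCMTwoRankZeroOfPubOfFlat` (stmt-BirchSwinnertonDyer-26471; derived
# node K2r0P stmt-BirchSwinnertonDyer-24945), line `rankzero` v16, stub (LDℓ)_A: the `2`-robust LOWER package READ WITH THE IWASAWA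
# INVOLUTION `ι : T ↦ (1+T)⁻¹ − 1` — the K3 lineage's v5 convention (`col`, `ι_P` `Λ`-linear on a COVARIANT local module, the
# Poitou–Tate map `j : P → X⁺` additive and `ι`-SEMILINEAR, the `𝐇¹`-side clause at the twisted prime `ι𝔭`)

HONEST FRAMING (cell `pub/bsd-wall`, W-ALL row 1; width seat `bsd-wall-tp2-p2-w2` g3, `--supports` only). THEOREMS ONLY — no definition,
no named fact, no instance, no `sorry`; route-independent (no `Theses`/`Cruxes` import; (LDℓ)_A written out verbatim); this file closes
no item; the crux is NOT proved; BSD is NOT proved by any of this.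

## Why this file

`…LowerOffTwoRobust` (p615838) reads the lower package with ALL maps `Λ`-linear for one `Λ`-structure on the local module `P`. The K3
lineage's convention audit (`Cruxes/SignedKatoDivisibilityUpToAtTwo/G4-CONVENTION-AUDIT.md`; kernel: `…KatoUpToAtTwoInvolChain`,
`…IwasawaInvolutionCompat`, `…SemilinearTransport`) shows how the `2`-adic objects actually arrive: Kato's `I = 𝐇¹_Γ(T₂E)` is
`Λ`-COVARIANT (`T ↦ conj_γ − 1`), the pinned duals `D`, `Y` carry PRE-composition by `conj_γ`, the local Tate pairing
`col : 𝐇¹ → P` and the Coleman map `ι_P : P → Λ` are `Λ`-linear for the covariant (contragredient) structure on `P`, and then the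
Poitou–Tate map `j : P → X⁺` is `ι`-SEMILINEAR (`j (g • y) = ι g • j y`), the `𝐇¹`-side comparison reads at `ι𝔭 = comap ι 𝔭`, and the
functional equation of `L♭` at `2` (`ι L♭ ≐ L♭`, tree) moves `ℓ_{ι𝔭}(Λ/(L♭))` back to `𝔭`. This file is the LOWER door in that convention,
so ONE provider (the K3 (D-layer)/PT programme + the CM `𝐇¹`-side port) serves K3's upper package and K2R0P♭'s lower package with
the SAME objects.

## What is proved

* §1 (rings `R ≃+* S` via `σ`, primes `𝔭 = σ⁻¹𝔓`) `fourTerm_lengthAt_ge_upTo_semilinear`: for `c : H → P`, `ι : P → R` linear over `R`,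
  `k : X ↠ Y` linear over `S`, `j : P → X` ADDITIVE `σ`-semilinear, `u ∉ 𝔭`, `u' ∉ 𝔓`, with (b♭) `j y = 0 ⟹ u·y ∈ range c` and (c♭)
  `u'·k(j y) = 0`: `ℓ_𝔓(Y) + ℓ_𝔭(R/(ι c z)) ≤ ℓ_𝔓(X) + ℓ_𝔭(H/Rz) + ℓ_𝔭(R/range ι)` (no hypothesis on `ker ι`, `ker c`, torsion, finiteness);
  `lengthAt_quotient_le_of_fourTerm_ge_upTo_semilinear`: with (e) `ℓ_𝔭(R/range ι) = 0`, (f) `ℓ_𝔭(R/(L)) ≤ ℓ_𝔭(R/(ι c z))` and the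
  MIXED-PRIME (g) `ℓ_𝔭(H/Rz) ≤ ℓ_𝔓(Y)`: `ℓ_𝔭(R/(L)) ≤ ℓ_𝔓(X)` — no cancellation.
* §2 `offTwoLower_of_lowerRobustPackageTwoInv` — (LDℓ)_A from, per `(D, 𝔭' ∌ 2)` of height one, a `2`-robust lower package with `j`
  additive `ι`-semilinear, (b♭), (c♭), (e), (f) AT `𝔭'` and (g)^ι `ℓ_{𝔭'}(𝐇¹/Λs) ≤ ℓ_{ι𝔭'}(X₀)` (print-exact twin of K3's (K2^ι)
  `ℓ_𝔭(X₀) ≤ ℓ_{ι𝔭}(𝐇¹/Λs)`). Road: package at `𝔮 = ι𝔭`, §1 with `σ = ι`, functional equation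
  `IwasawaInvolution.lengthAt_quotient_kobayashiL_comap_invol_eq`. PUB-free.
* §3 `offTwoLower_of_contragredientLocalDualPackageTwo` — the same with `j` CONSTRUCTED and (c) PROVED from a CONTRAGREDIENTLY pinned local
  dual: `r : Sel⁺(A/ℚ_∞) → S'` killing the classes with `res_𝔭 = 0`, `ψ'` with `r ∘ conj_{γ⁻¹} = ψ' ∘ r`, `dP : P → Hom(S', ℚ/ℤ)` with `T`
  acting through `ψ' − 1` (the action `(g·χ)(t) = χ(g⁻¹t)` for which the local Tate pairing IS `Λ`-linear from the covariant `𝐇¹`),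
  constants through `ℤ₂ → ℤ/2^k`; (PT♭) «`dP y` vanishes on `r(Sel⁺_∞)` ⟹ `C(2)^m·y ∈ range col`», (e), (f), (g)^ι. Inside: the `γ⁻¹`-twist
  `D'` of `D` (`IwasawaInvolution.exists_twist_signedSelmerDualData_invol`), the `Λ`-linear transpose into `D'`
  (`SignedKatoOffTwo.LocalChar.exists_linearTranspose`) pulled back to an `ι`-semilinear `j : P → D.X`.

References: [Kobayashi2003] Thm. 6.2–6.3 (p. 11), (7.17)–(7.21), Thm. 7.3, proof of Thm. 7.4, (8.23) (pp. 12–13, 18); [Kato2004Asterisque]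
Conj. 12.10 (p. 224), Lemma 15.13, (15.16.1) (pp. 264–265), §17.13 (p. 280); [GreenbergLNM1716] §1 (p. 60), §2; [MazurTateTeitelbaum1986Invent]
Ch. I §17; [Sprung2017] Cor. 4.14; [Bourbaki1989CommAlg] Ch. II §2.4.
-/

set_option autoImplicit false
-- the Theorems namespace of this sub repeats the summit name by design (D-0017 nested layout)
set_option linter.dupNamespace false

noncomputable section

open scoped Classical NumberField MatrixGroups ModularForm

open NumberField IsDedekindDomain CongruenceSubgroup

namespace Summit.BirchSwinnertonDyer.BirchSwinnertonDyer.Theorems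

open Literature.NumberTheory.EllipticCurves Literature.NumberTheory.GaloisRepresentations
  WeierstrassCurve ZpExtension Literature.NumberTheory.EllipticCurves.Kobayashi2003
  Literature.NumberTheory.EllipticCurves.Module Literature.NumberTheory.EllipticCurves.Kato2004
  Literature.NumberTheory.EllipticCurves.IwasawaDual Literature.NumberTheory.EllipticCurves.GreenbergSelmer
  Literature.NumberTheory.EllipticCurves.ModularForms Literature.NumberTheory.EllipticCurves.Rank1Residual
  Literature.NumberTheory.EllipticCurves.Rank1Residual.Typed
  Summit.BirchSwinnertonDyer.Rank1Residual Summit.BirchSwinnertonDyer.Rank1Residual.Supersingular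

namespace SignedLowerOffTwo

/-! ## §1 The reverse four-term inequality up to torsion, with an ADDITIVE `σ`-SEMILINEAR `j` -/

section Semilinear

variable {R : Type*} {S : Type*} [CommRing R] [CommRing S]
  {H P X Y : Type*} [AddCommGroup H] [_root_.Module R H] [AddCommGroup P] [_root_.Module R P]
  [AddCommGroup X] [_root_.Module S X] [AddCommGroup Y] [_root_.Module S Y]

/-- **The reverse four-term inequality up to torsion, semilinear version.** `σ : R ≃+* S`, primes `𝔭 = σ⁻¹(𝔓)`, `u ∉ 𝔭`, `u' ∉ 𝔓`;
`c : H → P`, `ι : P → R` linear over `R`, `k : X → Y` linear over `S` and ONTO, `j : P → X` ADDITIVE with `j (r • y) = σ r • j y`; (b♭)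
`j y = 0 ⟹ u · y ∈ range c`; (c♭) `u' · k (j y) = 0`. Then for every `z ∈ H`:
`ℓ_𝔓(Y) + ℓ_𝔭(R/(ι(c z))) ≤ ℓ_𝔓(X) + ℓ_𝔭(H/Rz) + ℓ_𝔭(R/range ι)`. Steps: `ℓ_𝔓(X) = ℓ_𝔓(ker k) + ℓ_𝔓(Y)`; `ℓ_𝔓(im j) ≤ ℓ_𝔓(ker k)`;
`ℓ_𝔓(im j) = ℓ_𝔭(P/ker j)` (semilinear TRANSPORT, `SignedKatoOffTwo.SemilinearTransport`); `ℓ_𝔭(P/range c) ≤ ℓ_𝔭(P/ker j)`; and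
`ℓ_𝔭(R/(ι c z)) ≤ ℓ_𝔭(P/range c) + ℓ_𝔭(H/Rz) + ℓ_𝔭(R/range ι)` = the un-twisted `fourTerm_lengthAt_ge_upTo` with `X := P/range c`,
`Y := 0`. With `σ = 1` this is `fourTerm_lengthAt_ge_upTo`; it is the `≥` twin of `SignedKatoOffTwo.fourTerm_lengthAt_le_upTo_semilinear`.
[cite: Kato2004Asterisque, §17.13 (p. 280)] [cite: Kobayashi2003, (7.17)–(7.21) and proof of Thm. 7.4 (pp. 12–13)]
[cite: Bourbaki1989CommAlg, Ch. II §2.4] -/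
theorem fourTerm_lengthAt_ge_upTo_semilinear (σ : R ≃+* S) {𝔭 : PrimeSpectrum R} {𝔓 : PrimeSpectrum S}
    (h𝔭 : 𝔭.asIdeal = 𝔓.asIdeal.comap σ) (ι : P →ₗ[R] R) (c : H →ₗ[R] P) (j : P →+ X)
    (hj : ∀ (r : R) (y : P), j (r • y) = σ r • j y) (k : X →ₗ[S] Y) {u : R} {u' : S}
    (hu : u ∉ 𝔭.asIdeal) (hu' : u' ∉ 𝔓.asIdeal)
    (hjc : ∀ y, j y = 0 → u • y ∈ LinearMap.range c) (hkj : ∀ y, u' • k (j y) = 0)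
    (hk : Function.Surjective k) (z : H) :
    lengthAt S Y 𝔓 + lengthAt R (R ⧸ Ideal.span {ι (c z)}) 𝔭 ≤
      lengthAt S X 𝔓 + lengthAt R (H ⧸ Submodule.span R {z}) 𝔭 + lengthAt R (R ⧸ LinearMap.range ι) 𝔭 := by
  obtain ⟨K, hK⟩ := SignedKatoOffTwo.SemilinearTransport.exists_ker_submodule σ j hj
  obtain ⟨L, hL⟩ := SignedKatoOffTwo.SemilinearTransport.exists_range_submodule σ j hj
  -- `ℓ_𝔓(X) = ℓ_𝔓(ker k) + ℓ_𝔓(Y)`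
  have hX : lengthAt S X 𝔓 = lengthAt S (LinearMap.ker k) 𝔓 + lengthAt S Y 𝔓 := by
    rw [lengthAt_eq_add_quotient (LinearMap.ker k) 𝔓, lengthAt_eq_of_linearEquiv (k.quotKerEquivOfSurjective hk) 𝔓]
  -- `ℓ_𝔓(im j) ≤ ℓ_𝔓(ker k)`
  have hB : lengthAt S L 𝔓 ≤ lengthAt S (LinearMap.ker k) 𝔓 := by
    refine lengthAt_le_of_smul_mem 𝔓 hu' fun x hx ↦ ?_
    obtain ⟨y, rfl⟩ := (hL x).1 hx
    rw [LinearMap.mem_ker, map_smul]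
    exact hkj y
  -- transport `ℓ_𝔓(im j) = ℓ_𝔭(P/ker j)`, and `ℓ_𝔭(P/range c) ≤ ℓ_𝔭(P/ker j)`
  have hT : lengthAt R (P ⧸ K) 𝔭 = lengthAt S L 𝔓 :=
    SignedKatoOffTwo.SemilinearTransport.lengthAt_quotient_ker_eq_lengthAt_range hj K hK L hL h𝔭
  have hC : lengthAt R (P ⧸ LinearMap.range c) 𝔭 ≤ lengthAt R (P ⧸ K) 𝔭 :=
    lengthAt_quotient_le_of_smul_mem 𝔭 hu fun y hy ↦ hjc y ((hK y).1 hy)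
  -- the un-twisted road with `X := P/range c`, `Y := 0`
  have hDE : lengthAt R (R ⧸ Ideal.span {ι (c z)}) 𝔭 ≤
      lengthAt R (P ⧸ LinearMap.range c) 𝔭 + lengthAt R (H ⧸ Submodule.span R {z}) 𝔭 +
        lengthAt R (R ⧸ LinearMap.range ι) 𝔭 := by
    have h := fourTerm_lengthAt_ge_upTo ι c (LinearMap.range c).mkQ
      (0 : (P ⧸ LinearMap.range c) →ₗ[R] (⊥ : Submodule R P)) (u := (1 : R)) 𝔭
      (fun h1 ↦ 𝔭.isPrime.ne_top ((Ideal.eq_top_iff_one _).mpr h1))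
      (fun y hy ↦ by
        rw [one_smul]
        rwa [Submodule.mkQ_apply, Submodule.Quotient.mk_eq_zero] at hy)
      (fun y ↦ smul_zero _)
      (fun y ↦ ⟨0, Subsingleton.elim _ _⟩) z
    rwa [lengthAt_eq_zero_of_subsingleton (M := (⊥ : Submodule R P)) 𝔭, zero_add] at h
  calc lengthAt S Y 𝔓 + lengthAt R (R ⧸ Ideal.span {ι (c z)}) 𝔭
      ≤ lengthAt S Y 𝔓 + (lengthAt S (LinearMap.ker k) 𝔓 + lengthAt R (H ⧸ Submodule.span R {z}) 𝔭 +
          lengthAt R (R ⧸ LinearMap.range ι) 𝔭) :=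
        add_le_add le_rfl (hDE.trans (add_le_add (add_le_add ((hC.trans (le_of_eq hT)).trans hB) le_rfl) le_rfl))
    _ = lengthAt S X 𝔓 + lengthAt R (H ⧸ Submodule.span R {z}) 𝔭 + lengthAt R (R ⧸ LinearMap.range ι) 𝔭 := by
        rw [hX]; ring

/-- **`ℓ_𝔭(R/(L)) ≤ ℓ_𝔓(X)` from the semilinear reverse package — no cancellation.** In the situation of
`fourTerm_lengthAt_ge_upTo_semilinear`, with (e) `ℓ_𝔭(R/range ι) = 0`, (f) `ℓ_𝔭(R/(L)) ≤ ℓ_𝔭(R/(ι(c z)))` and the MIXED-PRIME lower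
main-conjecture half (g) `ℓ_𝔭(H/Rz) ≤ ℓ_𝔓(Y)`: `ℓ_𝔭(R/(L)) ≤ ℓ_𝔓(X)`.
[cite: Kobayashi2003, proof of Thm. 7.4 (p. 13)] [cite: Kato2004Asterisque, §17.13 (p. 280)] -/
theorem lengthAt_quotient_le_of_fourTerm_ge_upTo_semilinear (σ : R ≃+* S) {𝔭 : PrimeSpectrum R} {𝔓 : PrimeSpectrum S}
    (h𝔭 : 𝔭.asIdeal = 𝔓.asIdeal.comap σ) (ι : P →ₗ[R] R) (c : H →ₗ[R] P) (j : P →+ X)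
    (hj : ∀ (r : R) (y : P), j (r • y) = σ r • j y) (k : X →ₗ[S] Y) {u : R} {u' : S}
    (hu : u ∉ 𝔭.asIdeal) (hu' : u' ∉ 𝔓.asIdeal)
    (hjc : ∀ y, j y = 0 → u • y ∈ LinearMap.range c) (hkj : ∀ y, u' • k (j y) = 0)
    (hk : Function.Surjective k) (z : H) {L : R}
    (hcoker : lengthAt R (R ⧸ LinearMap.range ι) 𝔭 = 0)
    (hL : lengthAt R (R ⧸ Ideal.span {L}) 𝔭 ≤ lengthAt R (R ⧸ Ideal.span {ι (c z)}) 𝔭)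
    (hz : lengthAt R (H ⧸ Submodule.span R {z}) 𝔭 ≤ lengthAt S Y 𝔓) :
    lengthAt R (R ⧸ Ideal.span {L}) 𝔭 ≤ lengthAt S X 𝔓 := by
  obtain ⟨K, hK⟩ := SignedKatoOffTwo.SemilinearTransport.exists_ker_submodule σ j hj
  obtain ⟨L', hL'⟩ := SignedKatoOffTwo.SemilinearTransport.exists_range_submodule σ j hj
  have hX : lengthAt S X 𝔓 = lengthAt S (LinearMap.ker k) 𝔓 + lengthAt S Y 𝔓 := by
    rw [lengthAt_eq_add_quotient (LinearMap.ker k) 𝔓, lengthAt_eq_of_linearEquiv (k.quotKerEquivOfSurjective hk) 𝔓]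
  have hB : lengthAt S L' 𝔓 ≤ lengthAt S (LinearMap.ker k) 𝔓 := by
    refine lengthAt_le_of_smul_mem 𝔓 hu' fun x hx ↦ ?_
    obtain ⟨y, rfl⟩ := (hL' x).1 hx
    rw [LinearMap.mem_ker, map_smul]
    exact hkj y
  have hT : lengthAt R (P ⧸ K) 𝔭 = lengthAt S L' 𝔓 :=
    SignedKatoOffTwo.SemilinearTransport.lengthAt_quotient_ker_eq_lengthAt_range hj K hK L' hL' h𝔭
  have hC : lengthAt R (P ⧸ LinearMap.range c) 𝔭 ≤ lengthAt R (P ⧸ K) 𝔭 :=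
    lengthAt_quotient_le_of_smul_mem 𝔭 hu fun y hy ↦ hjc y ((hK y).1 hy)
  have hDE : lengthAt R (R ⧸ Ideal.span {ι (c z)}) 𝔭 ≤
      lengthAt R (P ⧸ LinearMap.range c) 𝔭 + lengthAt R (H ⧸ Submodule.span R {z}) 𝔭 +
        lengthAt R (R ⧸ LinearMap.range ι) 𝔭 := by
    have h := fourTerm_lengthAt_ge_upTo ι c (LinearMap.range c).mkQ
      (0 : (P ⧸ LinearMap.range c) →ₗ[R] (⊥ : Submodule R P)) (u := (1 : R)) 𝔭
      (fun h1 ↦ 𝔭.isPrime.ne_top ((Ideal.eq_top_iff_one _).mpr h1))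
      (fun y hy ↦ by
        rw [one_smul]
        rwa [Submodule.mkQ_apply, Submodule.Quotient.mk_eq_zero] at hy)
      (fun y ↦ smul_zero _)
      (fun y ↦ ⟨0, Subsingleton.elim _ _⟩) z
    rwa [lengthAt_eq_zero_of_subsingleton (M := (⊥ : Submodule R P)) 𝔭, zero_add] at h
  rw [hcoker, add_zero] at hDE
  calc lengthAt R (R ⧸ Ideal.span {L}) 𝔭
      ≤ lengthAt R (P ⧸ LinearMap.range c) 𝔭 + lengthAt R (H ⧸ Submodule.span R {z}) 𝔭 := hL.trans hDE
    _ ≤ lengthAt S (LinearMap.ker k) 𝔓 + lengthAt S Y 𝔓 := add_le_add ((hC.trans (le_of_eq hT)).trans hB) hz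
    _ = lengthAt S X 𝔓 := hX.symm

end Semilinear

/-! ## §2 `p = 2`: (LDℓ)_A from the `ι`-twisted `2`-robust lower package -/

section AtTwo

/-- A power of an element outside a prime ideal is outside it. [folklore] -/
private theorem pow_not_mem {R : Type*} [CommRing R] (𝔭 : PrimeSpectrum R) {u : R} (hu : u ∉ 𝔭.asIdeal) (m : ℕ) :
    u ^ m ∉ 𝔭.asIdeal :=
  fun h ↦ hu (𝔭.isPrime.mem_of_pow_mem m h)

/-- **(LDℓ)_A from the `ι`-TWISTED `2`-robust LOWER package (K3 v5 convention; PUB-free).** If for every datum as in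
`offTwoLower_of_lowerRobustPackageTwo` (CM `A` off the unit zone, `κ, γ`, `f`, `ϖ`, Pollack pair, `D` with `X⁺` torsion, fine dual datum `Y`
with its surjective transpose `k : X⁺ → X₀`) and every height-one `𝔭' ∌ 2`, there are a pinned `I = 𝐇¹_Γ(T₂A)`, an abstract `Λ`-module `P`
with `Λ`-linear `ι_P : P → Λ` and `col : 𝐇¹ → P`, an ADDITIVE `j : P → X⁺` with `j (g • y) = (ι g) • j y` (`ι = IwasawaAlgebra.invol 2`),
`s ∈ 𝐇¹`, `m`, with (b♭) `j y = 0 ⟹ C(2)^m·y ∈ range col`, (c♭) `C(2)^m·k (j y) = 0`, (e) `ℓ_{𝔭'}(Λ/ι_P(P)) = 0`, (f)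
`ℓ_{𝔭'}(Λ/(L♭)) ≤ ℓ_{𝔭'}(Λ/(ι_P col s))` and (g)^ι `ℓ_{𝔭'}(𝐇¹/Λs) ≤ ℓ_{ι𝔭'}(X₀)` (`ι𝔭' = comap ι 𝔭'`; the print-exact twin of K3's
(K2^ι)), THEN (LDℓ)_A. Road: at the stub's `𝔭` take the package at `𝔮 = ι𝔭` (height one, `∌ C 2`:
`IwasawaInvolution.height_comap_invol`, `C_mem_comap_invol_iff`; `ι𝔮 = 𝔭`: `comap_invol_comap_invol`), §1 with `σ = ι` (`R`-prime `𝔮`,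
`S`-prime `𝔭`), and the functional equation `ℓ_𝔮(Λ/(L♭)) = ℓ_𝔭(Λ/(L♭))` (`IwasawaInvolution.lengthAt_quotient_kobayashiL_comap_invol_eq`, tree:
`ι L♭ ≐ L♭` for a Pollack pair at `a₂ = 0`). [cite: Kobayashi2003, (7.17)–(7.21), Thm. 7.3, proof of Thm. 7.4 (pp. 12–13)]
[cite: Kato2004Asterisque, Conj. 12.10 (p. 224), Lemma 15.13 and (15.16.1) (pp. 264–265), §17.13 (p. 280)] [cite: GreenbergLNM1716, §1 (p. 60)]
[cite: MazurTateTeitelbaum1986Invent, Ch. I §17] -/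
theorem offTwoLower_of_lowerRobustPackageTwoInv
    (hPkg : ∀ (A : WeierstrassCurve ℚ) [A.IsElliptic] [A.IsGloballyMinimal],
      A.HasCM → A.analyticRank = 0 → GoodSS A 2 → A.frobeniusTrace 2 = 0 →
      2 ∣ A.shaOrder * A.tamagawaProduct →
      ∀ (κ : ZpExtension ℚ 2) (γ : Field.absoluteGaloisGroup ℚ),
        κ.IsCyclotomic → κ.IsTopGenerator γ → IsCyclotomicVariable 2 γ →
      ∀ [NeZero (A.conductorNorm ℤ)] (f : CuspForm (Gamma0 (A.conductorNorm ℤ)) 2),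
        IsNewformOf A f → ∀ (ϖ : ℚ), (ϖ : ℝ) * A.realPeriodRat = plusPeriod f →
      ∀ (Lplus Lminus : IwasawaAlgebra 2), IsPollackPair f 2 Lplus Lminus →
      ∀ (D : SignedSelmerDualData A κ γ 1) [ContinuousSMul ℤ_[2] (A.tateModule 2)],
        Module.IsTorsion (IwasawaAlgebra 2) D.X →
      ∀ (Y : A.FineSelmerDualData κ γ) (k : D.X →ₗ[IwasawaAlgebra 2] Y.X), Function.Surjective k →
        (∀ (x : D.X) (s : A.fineSelmerInfty κ),
          Y.toDual (k x) s = D.toDual x (AddSubgroup.inclusion (fineSelmerInfty_le_signedSelmerInfty A κ 1) s)) →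
        ∀ 𝔭' : PrimeSpectrum (IwasawaAlgebra 2), 𝔭'.asIdeal.height = 1 →
          PowerSeries.C (2 : ℤ_[2]) ∉ 𝔭'.asIdeal →
        ∃ (I : Kato2004.IwasawaH1Data A 2 κ γ)
          (P : Type) (_ : AddCommGroup P) (_ : _root_.Module (IwasawaAlgebra 2) P)
          (ι : P →ₗ[IwasawaAlgebra 2] IwasawaAlgebra 2) (col : I.H →ₗ[IwasawaAlgebra 2] P)
          (j : P →+ D.X) (s : I.H) (m : ℕ),
          (∀ (g : IwasawaAlgebra 2) (y : P), j (g • y) = IwasawaAlgebra.invol 2 g • j y) ∧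
          (∀ y, j y = 0 → (PowerSeries.C (2 : ℤ_[2]) : IwasawaAlgebra 2) ^ m • y ∈ LinearMap.range col) ∧
          (∀ y, (PowerSeries.C (2 : ℤ_[2]) : IwasawaAlgebra 2) ^ m • k (j y) = 0) ∧
          lengthAt (IwasawaAlgebra 2) (IwasawaAlgebra 2 ⧸ LinearMap.range ι) 𝔭' = 0 ∧
          lengthAt (IwasawaAlgebra 2) (IwasawaAlgebra 2 ⧸ Ideal.span {kobayashiL 1 Lplus Lminus}) 𝔭' ≤
            lengthAt (IwasawaAlgebra 2) (IwasawaAlgebra 2 ⧸ Ideal.span {ι (col s)}) 𝔭' ∧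
          lengthAt (IwasawaAlgebra 2) (I.H ⧸ Submodule.span (IwasawaAlgebra 2) {s}) 𝔭' ≤
            lengthAt (IwasawaAlgebra 2) Y.X (PrimeSpectrum.comap (IwasawaAlgebra.invol 2).toRingHom 𝔭')) :
    ∀ (A : WeierstrassCurve ℚ) [A.IsElliptic] [A.IsGloballyMinimal],
      A.HasCM → A.analyticRank = 0 → GoodSS A 2 → A.frobeniusTrace 2 = 0 →
      2 ∣ A.shaOrder * A.tamagawaProduct →
      ∀ (κ : ZpExtension ℚ 2) (γ : Field.absoluteGaloisGroup ℚ),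
        κ.IsCyclotomic → κ.IsTopGenerator γ → IsCyclotomicVariable 2 γ →
      ∀ [NeZero (A.conductorNorm ℤ)] (f : CuspForm (Gamma0 (A.conductorNorm ℤ)) 2),
        IsNewformOf A f → ∀ (ϖ : ℚ), (ϖ : ℝ) * A.realPeriodRat = plusPeriod f →
      ∀ (Lplus Lminus : IwasawaAlgebra 2), IsPollackPair f 2 Lplus Lminus →
      ∀ (D : SignedSelmerDualData A κ γ 1), Module.IsTorsion (IwasawaAlgebra 2) D.X →
        ∀ 𝔭 : PrimeSpectrum (IwasawaAlgebra 2), 𝔭.asIdeal.height = 1 →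
          PowerSeries.C (2 : ℤ_[2]) ∉ 𝔭.asIdeal →
          lengthAt (IwasawaAlgebra 2) (IwasawaAlgebra 2 ⧸ Ideal.span {kobayashiL 1 Lplus Lminus}) 𝔭 ≤
            lengthAt (IwasawaAlgebra 2) D.X 𝔭 := by
  intro A _ _ hcm hr hss ha hz κ γ hκ hγ hcv _ f hf ϖ hϖ Lplus Lminus hPP D hX 𝔭 h𝔭 hp𝔭
  haveI : ContinuousSMul ℤ_[2] (A.tateModule 2) := TateModule.continuousSMul_padicInt
  obtain ⟨Y⟩ := A.nonempty_fineSelmerDualData κ hγ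
  obtain ⟨k, hk, hkY⟩ := D.exists_linearMap_toFineDual hγ Y
  -- the involution and the twisted prime `𝔮 = ι𝔭`
  let ιe : IwasawaAlgebra 2 ≃+* IwasawaAlgebra 2 := (IwasawaAlgebra.involEquiv 2 : IwasawaAlgebra 2 ≃+* IwasawaAlgebra 2)
  set 𝔮 : PrimeSpectrum (IwasawaAlgebra 2) := PrimeSpectrum.comap (IwasawaAlgebra.invol 2).toRingHom 𝔭 with h𝔮def
  have h𝔮𝔭 : 𝔮.asIdeal = 𝔭.asIdeal.comap ιe :=
    SignedKatoOffTwo.IwasawaInvolution.ideal_comap_invol_toRingHom 2 𝔭.asIdeal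
  have h𝔮 : 𝔮.asIdeal.height = 1 := by
    rw [h𝔮def, SignedKatoOffTwo.IwasawaInvolution.height_comap_invol, h𝔭]
  have hp𝔮 : PowerSeries.C (2 : ℤ_[2]) ∉ 𝔮.asIdeal := fun h ↦
    hp𝔭 ((SignedKatoOffTwo.IwasawaInvolution.C_mem_comap_invol_iff 2 (2 : ℤ_[2]) 𝔭).mp h)
  -- the package AT `𝔮`
  obtain ⟨I, P, _, _, ιP, col, j, s, m, hj, hjc, hkj, hcoker, hdiv, hIMC⟩ :=
    hPkg A hcm hr hss ha hz κ γ hκ hγ hcv f hf ϖ hϖ Lplus Lminus hPP D hX Y k hk hkY 𝔮 h𝔮 hp𝔮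
  rw [h𝔮def, SignedKatoOffTwo.IwasawaInvolution.comap_invol_comap_invol] at hIMC
  have h := lengthAt_quotient_le_of_fourTerm_ge_upTo_semilinear ιe h𝔮𝔭 ιP col j (fun g y ↦ hj g y) k
    (pow_not_mem 𝔮 hp𝔮 m) (pow_not_mem 𝔭 hp𝔭 m) hjc hkj hk s hcoker hdiv hIMC
  rwa [h𝔮def, SignedKatoOffTwo.IwasawaInvolution.lengthAt_quotient_kobayashiL_comap_invol_eq hf hss ha hPP 𝔭] at h

end AtTwo

/-! ## §3 `p = 2`: the package from a CONTRAGREDIENTLY pinned local dual — `j` constructed `ι`-semilinear, (c) proved -/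

section Contragredient

/-- **An `ι`-semilinear transpose into `X^ε` from a contragrediently pinned local dual.** `D` a pinned dual of `Sel^ε(A/K_∞)` for `γ`;
`r : Sel^ε_∞ → S'` additive, `ψ'` with `r ∘ conj_{γ⁻¹} = ψ' ∘ r`; `dP : P → Hom(S', ℚ/ℤ)` with `T` acting through `ψ' − 1` and constants
through `ℤ_p → ℤ/p^k` on `p^k`-torsion. Then there is an ADDITIVE `j : P → D.X` with `D.toDual (j y) s = dP y (r s)` and
`j (g • y) = (IwasawaAlgebra.invol p g) • j y`: the `Λ`-linear transpose into the `γ⁻¹`-twist `D'` of `D`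
(`IwasawaInvolution.exists_twist_signedSelmerDualData_invol`, `SignedKatoOffTwo.LocalChar.exists_linearTranspose`) pulled back along
`D.X ≃ D'.X`. [cite: Kobayashi2003, Thm. 1.2 (the object) and (8.23) (pp. 2, 18)] [cite: GreenbergLNM1716, §1 (p. 60)] -/
theorem exists_involTranspose {K : Type} [Field K] [NumberField K] {A : WeierstrassCurve K} {p : ℕ} [Fact p.Prime]
    {κ : ZpExtension K p} {γ : Field.absoluteGaloisGroup K} {ε : ℤˣ} (D : SignedSelmerDualData A κ γ ε)
    {S' : Type*} [AddCommGroup S'] (r : signedSelmerInfty A κ ε →+ S') (ψ' : S' →+ S')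
    (hr : ∀ t : signedSelmerInfty A κ ε, r (conjSignedSelmerInfty A κ ε γ⁻¹ t) = ψ' (r t))
    {P : Type*} [AddCommGroup P] [_root_.Module (IwasawaAlgebra p) P] (dP : P →+ (S' →+ AddCircle (1 : ℚ)))
    (hT : ∀ (y : P) (t : S'), dP ((PowerSeries.X : IwasawaAlgebra p) • y) t = dP y (ψ' t) - dP y t)
    (hC : ∀ (c : ℤ_[p]) (y : P) (t : S') (n : ℕ), p ^ n • t = 0 →
      dP ((PowerSeries.C c : IwasawaAlgebra p) • y) t = (PadicInt.toZModPow n c).val • dP y t) :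
    ∃ j : P →+ D.X, (∀ (y : P) (s : signedSelmerInfty A κ ε), D.toDual (j y) s = dP y (r s)) ∧
      ∀ (g : IwasawaAlgebra p) (y : P), j (g • y) = IwasawaAlgebra.invol p g • j y := by
  obtain ⟨D', e, he, hdual, -⟩ :=
    SignedKatoOffTwo.IwasawaInvolution.exists_twist_signedSelmerDualData_invol (mul_inv_cancel γ) D
  obtain ⟨j', hj'⟩ := SignedKatoOffTwo.LocalChar.exists_linearTranspose A p κ ε D' r dP ψ' hr hT hC
  let j : P →+ D.X :=
    { toFun := fun y ↦ e.symm (j' y),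
      map_zero' := by rw [map_zero, map_zero],
      map_add' := fun a b ↦ by rw [map_add, map_add] }
  refine ⟨j, fun y s ↦ ?_, fun g y ↦ ?_⟩
  · show D.toDual (e.symm (j' y)) s = dP y (r s)
    rw [← hdual, AddEquiv.apply_symm_apply]
    exact hj' y s
  · show e.symm (j' (g • y)) = IwasawaAlgebra.invol p g • e.symm (j' y)
    apply e.injective
    rw [AddEquiv.apply_symm_apply, map_smul, he, IwasawaAlgebra.invol_invol, AddEquiv.apply_symm_apply]

/-- **(LDℓ)_A from a lower package on a CONTRAGREDIENTLY pinned local dual (K3 v5 convention): `j` constructed `ι`-semilinear, clause (c)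
proved, (PT♭) the only global clause.** Fix `v ∋ 2`. If for every datum (CM `A` off the unit zone, `κ, γ`, `f`, `ϖ`, Pollack pair, `D` with
`X⁺` torsion, fine dual datum `Y`) and every height-one `𝔭' ∌ 2` there are: `I = 𝐇¹_Γ(T₂A)` pinned; an abelian group `S'` with an additive
`r : Sel⁺(A/ℚ_∞) → S'` KILLING the classes with `res_{Gal(ℚ̄/ℚ_∞) ⊓ D_v} = 0`, and `ψ'` with `r ∘ conj_{γ⁻¹} = ψ' ∘ r`; a `Λ`-module `P` with
`dP : P → Hom(S', ℚ/ℤ)`, `T` acting through `ψ' − 1` (the CONTRAGREDIENT action — the one for which the `T₂A`-adic local Tate pairing from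
the covariant `𝐇¹` is `Λ`-linear), constants through `ℤ₂ → ℤ/2^n`; `Λ`-linear `ι_P : P → Λ`, `col : 𝐇¹ → P`; `s ∈ 𝐇¹`, `m`; with (PT♭)
«`dP y` vanishes on `r(Sel⁺_∞)` ⟹ `C(2)^m·y ∈ range col`», (e) `ℓ_{𝔭'}(Λ/ι_P(P)) = 0`, (f) `ℓ_{𝔭'}(Λ/(L♭)) ≤ ℓ_{𝔭'}(Λ/(ι_P col s))`,
(g)^ι `ℓ_{𝔭'}(𝐇¹/Λs) ≤ ℓ_{ι𝔭'}(X₀)` — THEN (LDℓ)_A (`exists_involTranspose`, `comp_transpose_eq_zero_of_resOfLe`, §2).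
[cite: Kobayashi2003, Thm. 6.2–6.3, (7.17)–(7.21), Thm. 7.3, (8.23) (pp. 11–13, 18)] [cite: Kato2004Asterisque, Conj. 12.10 (p. 224),
Lemma 15.13 and (15.16.1) (pp. 264–265), §17.13 (p. 280)] [cite: GreenbergLNM1716, §1–2] -/
theorem offTwoLower_of_contragredientLocalDualPackageTwo (v : HeightOneSpectrum (𝓞 ℚ)) (hv : ((2 : ℕ) : 𝓞 ℚ) ∈ v.asIdeal)
    (hPkg : ∀ (A : WeierstrassCurve ℚ) [A.IsElliptic] [A.IsGloballyMinimal],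
      A.HasCM → A.analyticRank = 0 → GoodSS A 2 → A.frobeniusTrace 2 = 0 →
      2 ∣ A.shaOrder * A.tamagawaProduct →
      ∀ (κ : ZpExtension ℚ 2) (γ : Field.absoluteGaloisGroup ℚ),
        κ.IsCyclotomic → κ.IsTopGenerator γ → IsCyclotomicVariable 2 γ →
      ∀ [NeZero (A.conductorNorm ℤ)] (f : CuspForm (Gamma0 (A.conductorNorm ℤ)) 2),
        IsNewformOf A f → ∀ (ϖ : ℚ), (ϖ : ℝ) * A.realPeriodRat = plusPeriod f →
      ∀ (Lplus Lminus : IwasawaAlgebra 2), IsPollackPair f 2 Lplus Lminus →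
      ∀ (D : SignedSelmerDualData A κ γ 1) [ContinuousSMul ℤ_[2] (A.tateModule 2)],
        Module.IsTorsion (IwasawaAlgebra 2) D.X →
      ∀ (Y : A.FineSelmerDualData κ γ),
        ∀ 𝔭' : PrimeSpectrum (IwasawaAlgebra 2), 𝔭'.asIdeal.height = 1 →
          PowerSeries.C (2 : ℤ_[2]) ∉ 𝔭'.asIdeal →
        ∃ (I : Kato2004.IwasawaH1Data A 2 κ γ)
          (S' : Type) (_ : AddCommGroup S') (r : signedSelmerInfty A κ 1 →+ S') (ψ' : S' →+ S')
          (P : Type) (_ : AddCommGroup P) (_ : _root_.Module (IwasawaAlgebra 2) P)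
          (dP : P →+ (S' →+ AddCircle (1 : ℚ)))
          (ι : P →ₗ[IwasawaAlgebra 2] IwasawaAlgebra 2) (col : I.H →ₗ[IwasawaAlgebra 2] P) (s : I.H) (m : ℕ),
          (∀ t : signedSelmerInfty A κ 1,
            resOfLe (A.geomPrimaryTorsion 2) (inf_le_left : κ.kerSubgroup ⊓ decomp v ≤ κ.kerSubgroup)
              (t : A.subgroupH1 2 κ.kerSubgroup) = 0 → r t = 0) ∧
          (∀ t : signedSelmerInfty A κ 1, r (conjSignedSelmerInfty A κ 1 γ⁻¹ t) = ψ' (r t)) ∧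
          (∀ (y : P) (t : S'), dP ((PowerSeries.X : IwasawaAlgebra 2) • y) t = dP y (ψ' t) - dP y t) ∧
          (∀ (c : ℤ_[2]) (y : P) (t : S') (n : ℕ), 2 ^ n • t = 0 →
            dP ((PowerSeries.C c : IwasawaAlgebra 2) • y) t = (PadicInt.toZModPow n c).val • dP y t) ∧
          (∀ y : P, (∀ t : signedSelmerInfty A κ 1, dP y (r t) = 0) →
            (PowerSeries.C (2 : ℤ_[2]) : IwasawaAlgebra 2) ^ m • y ∈ LinearMap.range col) ∧
          lengthAt (IwasawaAlgebra 2) (IwasawaAlgebra 2 ⧸ LinearMap.range ι) 𝔭' = 0 ∧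
          lengthAt (IwasawaAlgebra 2) (IwasawaAlgebra 2 ⧸ Ideal.span {kobayashiL 1 Lplus Lminus}) 𝔭' ≤
            lengthAt (IwasawaAlgebra 2) (IwasawaAlgebra 2 ⧸ Ideal.span {ι (col s)}) 𝔭' ∧
          lengthAt (IwasawaAlgebra 2) (I.H ⧸ Submodule.span (IwasawaAlgebra 2) {s}) 𝔭' ≤
            lengthAt (IwasawaAlgebra 2) Y.X (PrimeSpectrum.comap (IwasawaAlgebra.invol 2).toRingHom 𝔭')) :
    ∀ (A : WeierstrassCurve ℚ) [A.IsElliptic] [A.IsGloballyMinimal],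
      A.HasCM → A.analyticRank = 0 → GoodSS A 2 → A.frobeniusTrace 2 = 0 →
      2 ∣ A.shaOrder * A.tamagawaProduct →
      ∀ (κ : ZpExtension ℚ 2) (γ : Field.absoluteGaloisGroup ℚ),
        κ.IsCyclotomic → κ.IsTopGenerator γ → IsCyclotomicVariable 2 γ →
      ∀ [NeZero (A.conductorNorm ℤ)] (f : CuspForm (Gamma0 (A.conductorNorm ℤ)) 2),
        IsNewformOf A f → ∀ (ϖ : ℚ), (ϖ : ℝ) * A.realPeriodRat = plusPeriod f →
      ∀ (Lplus Lminus : IwasawaAlgebra 2), IsPollackPair f 2 Lplus Lminus →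
      ∀ (D : SignedSelmerDualData A κ γ 1), Module.IsTorsion (IwasawaAlgebra 2) D.X →
        ∀ 𝔭 : PrimeSpectrum (IwasawaAlgebra 2), 𝔭.asIdeal.height = 1 →
          PowerSeries.C (2 : ℤ_[2]) ∉ 𝔭.asIdeal →
          lengthAt (IwasawaAlgebra 2) (IwasawaAlgebra 2 ⧸ Ideal.span {kobayashiL 1 Lplus Lminus}) 𝔭 ≤
            lengthAt (IwasawaAlgebra 2) D.X 𝔭 := by
  refine offTwoLower_of_lowerRobustPackageTwoInv
    fun A _ _ hcm hr hss ha hz κ γ hκ hγ hcv _ f hf ϖ hϖ Lplus Lminus hPP D _ hX Y k hk hkY 𝔭 h𝔭 hp𝔭 ↦ ?_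
  obtain ⟨I, S', _, r, ψ', P, _, _, dP, ι, col, s, m, hr0, hr, hT, hC, hPT, hcoker, hdiv, hIMC⟩ :=
    hPkg A hcm hr hss ha hz κ γ hκ hγ hcv f hf ϖ hϖ Lplus Lminus hPP D hX Y 𝔭 h𝔭 hp𝔭
  obtain ⟨j, hj, hjι⟩ := exists_involTranspose D r ψ' hr dP hT (fun c y t n hn ↦ hC c y t n (by exact_mod_cast hn))
  refine ⟨I, P, inferInstance, inferInstance, ι, col, j, s, m, hjι, fun y hy ↦ hPT y fun t ↦ ?_, fun y ↦ ?_, hcoker, hdiv, hIMC⟩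
  · rw [← hj, hy, map_zero, AddMonoidHom.zero_apply]
  · have h0 : k (j y) = 0 := comp_transpose_eq_zero_of_resOfLe hκ v hv D Y k hkY r hr0 dP j hj y
    rw [h0, smul_zero]

end Contragredient

end SignedLowerOffTwo

end Summit.BirchSwinnertonDyer.BirchSwinnertonDyer.Theorems

end
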